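import Summits.QuantumAdvantage.QuantumAdvantage.Theses.CubicForrelation
import Literature.Computability.QuantumComplexity.SignedCubicForrelation
import Literature.Computability.QuantumComplexity.ForrelationSignTransport
import Literature.Computability.QuantumComplexity.ForrelationMSubspaceDuality
import Literature.Computability.Complexity.F2RowReduction
import Literature.Computability.Complexity.StackLists
import Summits.QuantumAdvantage.QuantumAdvantage.Theorems.SignedCubicForrelationInPrBPP.Negative.GoldCube

/-!
# Line `oil-slice-radicals` — NEGATIVE skeleton for crux `SignedExactCubicForrelationNotPrBPP` (stmt-QuantumAdvantage-13932)

Crux (route `QuantumAdvantage/CubicForrelation`, rank 3, item r3):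
`Summit.QuantumAdvantage.QuantumAdvantage.Theses.CubicForrelation.SignedExactCubicForrelationNotPrBPP`
`= (signedExactCubicForrelationProblem 2 ∉ PromiseBPP')` (`rfl`): the SIGNED EXACT slice of cubic 2-fold
Forrelation (YES `Φ = 1`: `b` bent with cubic dual `b̃ = a`; NO `Φ = -1`: `a = b̃ ⊕ 1`; `n` even, both
`B₂`-circuits of 𝔽₂-degree `≤ 3`) is not in textbook promise-BPP.

Idea card `Cruxes/SignedExactCubicForrelationNotPrBPP/Ideas/oil-slice-radicals.md` (crux-ideate r1, ideator 2;
triage r1: pass ×3, merge-noted with `stationary-flat-sign` / `dual-pingpong-frame`; companion readout card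
`window-sign-leak`), line card `Lines/oil-slice-radicals.md`.

DIRECTION. The idea is a REFUTATION lever (Kipnis–Shamir reading of a hidden Maiorana–McFarland cubic: the
radical of every slice `T_b(·,w,·)` of the cubic tensor contains OIL vectors, the oil space is a certified
M-subspace, and one window decides the sign), so the honest composition below concludes
`¬ SignedExactCubicForrelationNotPrBPP` — the crux's NEGATION by name — not the crux. A theorem concluding the
crux BY NAME cannot be made from this lever without costume (triage r1 ×3: no proof-side line exists for this
separation-barred crux), so `ledger skeleton check` reports `skeleton.missing` BY DESIGN; the file is
`lean check` rc 0 with `sorry` only inside the six `stub_*`. Consumers: the crux's standing disprover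
(`Disproof.lean`, near-miss `crux_false_sketch` — this file is its skeleton), the lead of the r7 line
`Cruxes/SignedCubicForrelationInPrBPP/Lines/polar_radical_seeds.lean` (whose bonus `not_signedExactNotPrBPP_of`
takes `ExactPairsHaveMSubspace` as a hypothesis — `stub_dillonOfMM` below discharges it from crux r5 — and whose
`MSubspaceFinder` implies our `OilFinder`, `oilFinder_of_mSubspaceFinder`), and the tenure planner (KILL
CRITERIA of the route: r3 refuted ⇒ restate X at `k = 3`).

THE LINE (`n = 2m`; everything white-box on the ANF / the two circuits):
* STRUCTURE (finite linear algebra over 𝔽₂, provable now). For a cubic `b` and ANY M-subspace `V` (xor-closed,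
  `b` affine on every coset) and ANY direction `w`, the slice radical `R_w = {u : D_uD_wD_v b ≡ 0 ∀ v}` satisfies
  SLICE HEREDITY `|R_w|·|V|² ≤ |R_w ∩ V|²·2ⁿ` (`stub_sliceHeredity`): for `|V|² = 2ⁿ` this is `|R_w| ≤ |R_w ∩ V|²`,
  so (i) every slice radical contains a non-zero OIL vector (`w ∈ R_w`; the card's `SliceRadicalOil` = triage's
  PolarLeak = Negative-note F1 — PROVED below from heredity, `sliceRadicalOil_of_heredity`) and (ii) junk is
  rank-penalised (the card's half-rank gap `rank T(v,·,·) ≥ 2·rank N_{v''}`, i.e. a non-oil survivor of the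
  `|R| ≤ 2^m`-filter must carry `≥ m/2` oil dimensions in its own radical). EXHAUSTION (`stub_balancedDegenerate`):
  every non-zero component `c·π` of a quadratic PERMUTATION is balanced, hence not bent, hence has a degenerate
  symplectic form — so every oil direction is produced by some slice (no property of `π` beyond bijectivity).
* FINDER (`stub_oilRecovery`, the line's OPEN stub = the card's Transfer C⁻⁻ "MM oil recovery ∈ FBPP", stated as
  the Las Vegas specification `OilFinder`: on every exact cubic instance whose second function has an M-subspace,
  output CERTIFIED rows spanning one, with probability `≥ 2/3`, in polynomial time). Intended witness: random
  slices → radicals by elimination → half-rank filter → pairwise-compatible extraction (`T(u,u',·) = 0`,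
  `D_uD_{u'} b(0) = 0`: the E-closure) → certify; 36/36 + kit j007587 (card), and the same geometry solved every MM
  family anyone generated (biiso v3 48/48 n ≤ 80, msub_attack 40/40 n ≤ 96, kernel_attack, flatsign4; 0 wrong signs).
* READOUT (`stub_windowSign`, provable now from the LANDED sign transport `ForrelationSignTransport.lean` p72523):
  if `Φ(a,b) = ±1`, `V` is a half-dimensional subspace and `b(v) = b(0) ⊕ s·v` on `V`, then `Φ = (-1)^{a(s)+b(0)}`
  — ONE value of `a` decides (companion card `window-sign-leak`: `c = a(λ̂) ⊕ b(0)`).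
* DECIDER (`stub_exactDecider`, XL formalisation, mathematics closed): finder + certificate + slope solve + one
  evaluation of each circuit, wrapped by `PromiseProblem.mem_PromiseBPP'_of_fp_decider` ⇒ the MM side of the
  signed exact slice is in `PromiseBPP'`.
* TOTALITY (`stub_dillonOfMM`, provable now: Dillon's criterion, easy direction, template
  `Theorems/ExactPairsMaioranaMcFarland/Negative/DillonCertificate.lean: mm_family`): crux r5
  `ExactPairsMaioranaMcFarland` (route item, hypothesis BY NAME of the composition) puts every exact cubic pair on
  the MM side (`Φ = -1` via `(¬a, b)`).
Composition: `not_SignedExactCubicForrelationNotPrBPP_of : stub₁ → … → stub₆ → ExactPairsMaioranaMcFarland → ¬ crux`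
(promise bookkeeping only; kernel-checked, no `sorry`).

Disproof.lean (cdisprove cycle 1) used: no `_false_without_<H>` theorem exists (S has no hypotheses); (a) ★ sign
transport LANDED — `stub_windowSign` is its corollary and must be proved FROM it (not re-derived); (a′) M-subspace
duality LANDED — not needed by this readout (the window form needs `b` affine on ONE flat only); (b) biiso table —
same geometry, our finder differs in the seed step (single-slice radicals + half-rank filter); (c) honest residue —
(c)1 plumbing is `stub_exactDecider` (now largely reuse: r4's `CubicForrelationEstimatorMachine.lean` landed),
(c)2 worst-case finder = `stub_oilRecovery` (THE open stub), (c)3 non-MM pairs = hypothesis r5; (d) refuted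
strengthenings S⁺¹–S⁺⁴ — consistent (we USE that an M-subspace as advice kills S); (e) near-miss `crux_false_sketch`
— this file is its decomposition. Landed Negative lemmas checked against: `Negative.GoldCube` (biquadratic
permutation WITHOUT affine component, `Rad T = 0` family): the finder never starts from an affine component or a
radical, and `stub_balancedDegenerate` holds on it (`example` below, by `decide`). Negatives index
(`ledger negatives`): CubicStability (2202) refuted — used nowhere; nothing else nearby.
-/

noncomputable section

set_option linter.dupNamespace false

namespace Summit.QuantumAdvantage.QuantumAdvantage.Cruxes.SignedExactCubicForrelationNotPrBPP.OilSliceRadicals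

open Finset
open Literature.Computability.Complexity Literature.Computability.QuantumComplexity
open Literature.Computability.QuantumComplexity.BuzetChailloux (bxor zeroVec bxor_zeroVec zeroVec_bxor
  bxor_bxor_cancel_left bxor_comm bxor_self)
open Summit.QuantumAdvantage.QuantumAdvantage.Theses.CubicForrelation

variable {n : ℕ}

/-! ## Vocabulary of the line (definitions; every stub is stated over these and tree declarations) -/

/-- First finite difference `D_u f (y) = f(y) ⊕ f(y ⊕ u)`. [folklore] -/
def deriv (f : (Fin n → Bool) → Bool) (u : Fin n → Bool) : (Fin n → Bool) → Bool :=
  fun y => f y ^^ f (bxor y u)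

/-- Second difference `D_u D_v f`. For quadratic `f` it is constant in `y`: the symplectic (polar) form
`β_f(u,v)`. [folklore] -/
def deriv2 (f : (Fin n → Bool) → Bool) (u v : Fin n → Bool) : (Fin n → Bool) → Bool :=
  deriv (deriv f v) u

/-- Third difference `D_u D_v D_w f`. For cubic `f` it is constant in `y`: the (symmetric, alternating)
trilinear form `T_f(u,v,w)` of the cubic part of the ANF. [folklore] -/
def deriv3 (f : (Fin n → Bool) → Bool) (u v w : Fin n → Bool) : (Fin n → Bool) → Bool :=
  deriv (deriv2 f v w) u

/-- The SLICE RADICAL `R_w(b) = rad T_b(·,w,·) = {u : T_b(u,w,v) = 0 for all v}` (all third differences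
`D_uD_wD_v b` vanish identically) — the kernel of the alternating matrix `B_w = T_b(·,w,·)`, computable by
Gaussian elimination from the `O(n³)` cubic ANF coefficients. Always contains `0` and `w`. [folklore] -/
def sliceRad (b : (Fin n → Bool) → Bool) (w : Fin n → Bool) : Finset (Fin n → Bool) :=
  univ.filter fun u => ∀ v y, deriv3 b u w v y = false

theorem mem_sliceRad {b : (Fin n → Bool) → Bool} {w u : Fin n → Bool} :
    u ∈ sliceRad b w ↔ ∀ v y, deriv3 b u w v y = false := by
  simp [sliceRad]

/-- All second differences of `g` along `V` vanish (`g` is affine on every coset of `V`): the M-subspace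
condition, verbatim the hypothesis `hM` of `DerivativeWalsh.dual_affine_on_perp_cosets` and verbatim the r7 line's
`PolarRadicalSeeds.AffineOnCosets`. [cite: Carlet2020, Prop. 54] -/
def AffineOnCosets (g : (Fin n → Bool) → Bool) (V : Finset (Fin n → Bool)) : Prop :=
  ∀ u ∈ V, ∀ v ∈ V, ∀ y, (g y ^^ g (bxor y u) ^^ g (bxor y v) ^^ g (bxor y (bxor u v))) = false

/-- `g : {0,1}ⁿ → {0,1}` HAS a half-dimensional M-subspace: a finset `V ∋ 0` closed under `⊕` with `|V|² = 2ⁿ`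
on whose cosets `g` is affine (Dillon's criterion for the completed Maiorana–McFarland class; for a hidden MM cubic
`b' = b∘(Ay ⊕ t) ⊕ affine`, `b = y'·π(y'') ⊕ h(y'')`, the OIL SPACE `A⁻¹{y'' = 0}` is one). Verbatim the r7 line's
`PolarRadicalSeeds.HasMSubspace`. [cite: Carlet2020, Prop. 54] -/
def HasMSubspace (g : (Fin n → Bool) → Bool) : Prop :=
  ∃ V : Finset (Fin n → Bool), zeroVec ∈ V ∧ (∀ x ∈ V, ∀ y ∈ V, bxor x y ∈ V) ∧
    (V.card : ℝ) ^ 2 = (2 : ℝ) ^ n ∧ AffineOnCosets g V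

/-- The 𝔽₂ inner product `x · y` as a Boolean (same fold as `Negative.GoldCube.dotB`). [folklore] -/
def bdot {m : ℕ} (x y : Fin m → Bool) : Bool :=
  (List.finRange m).foldr (fun i acc => xor (x i && y i) acc) false

/-- The bit vector `v` read in `𝔽₂ⁿ`. -/
def toF2 (v : Fin n → Bool) : Fin n → ZMod 2 := fun i => if v i then 1 else 0

/-- The finset of bit vectors lying in the `𝔽₂`-row span of a list of rows (`F2Elim.rowSpan`). -/
def spanSet (n : ℕ) (L : List (List Bool)) : Finset (Fin n → Bool) :=
  @Finset.filter _ (fun v => toF2 v ∈ F2Elim.rowSpan n L) (Classical.decPred _) Finset.univ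

/-- The rows `L` SPAN a half-dimensional M-subspace of `g`: their span `V` has `|V|² = 2ⁿ` and `g` is affine on the
cosets of `V` — a poly-time CERTIFIABLE condition for cubic `g` (rank `n/2` by elimination; the degree-`≤ 1`
functions `D_uD_v g`, `u v` rows, vanish at `0` and at the unit vectors). Verbatim the r7 line's
`PolarRadicalSeeds.SpansMSubspace`. [folklore] -/
def SpansMSubspace (n : ℕ) (g : (Fin n → Bool) → Bool) (L : List (List Bool)) : Prop :=
  ((spanSet n L).card : ℝ) ^ 2 = (2 : ℝ) ^ n ∧ AffineOnCosets g (spanSet n L)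

/-! ### The six statements -/

/-- **SLICE HEREDITY** (the lever; facts (1) + (3) of the idea card in one inequality). `b` cubic, `V ∋ 0`
xor-closed with `b` affine on every coset of `V` (so the trilinear form `T_b` is isotropic on `V`). Then for EVERY
direction `w` the slice radical `R_w = rad T_b(·,w,·)` satisfies `|R_w| · |V|² ≤ |R_w ∩ V|² · 2ⁿ`, i.e.
`dim R_w ≤ 2·dim(R_w ∩ V) + (n − 2 dim V)`. Proof (5 lines of linear algebra over `𝔽₂`): `e ↦ T_b(w,e,·)` maps `V`
into the annihilator of `V + R_w` (isotropy, symmetry of `T_b`, definition of `R_w`) with kernel `V ∩ R_w`;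
rank–nullity and `dim(V + R_w) = dim V + dim R_w − dim(V ∩ R_w)`. For `|V|² = 2ⁿ`: `|R_w| ≤ |R_w ∩ V|²` — every
slice radical is at least "half oil" logarithmically; since `w ∈ R_w`, it contains a non-zero oil vector
(`sliceRadicalOil_of_heredity`), and a non-oil vector surviving the filter `|R_u| ≤ 2^{n/2}` has `≥ n/4` oil
dimensions in its own radical (the half-rank gap). No bentness, no permutation, no template. [folklore] -/
def SliceHeredity : Prop :=
  ∀ (n : ℕ) (b : (Fin n → Bool) → Bool) (V : Finset (Fin n → Bool)),
    IsDegLeFun 3 b → zeroVec ∈ V → (∀ x ∈ V, ∀ y ∈ V, bxor x y ∈ V) → AffineOnCosets b V →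
    ∀ w : Fin n → Bool, (sliceRad b w).card * V.card ^ 2 ≤ (sliceRad b w ∩ V).card ^ 2 * 2 ^ n

/-- **BALANCED ⇒ DEGENERATE** (fact (2), exhaustion of the oil directions). Every non-zero component `c·π` of a
quadratic PERMUTATION `π` of `𝔽₂^m` has a non-zero vector `w` in the radical of its symplectic form
(`D_wD_v(c·π) ≡ 0` for all `v`). Proof: `c·π` is balanced (`π` bijective, `c ≠ 0`), and a quadratic form with
non-degenerate symplectic form is bent, `(∑_x (-1)^{q(x)})² = 2^m · ∑_{u ∈ rad β_q} (-1)^{q(u)+q(0)} = 2^m ≠ 0`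
(Dickson); for `m` odd automatic. Read through the MM template `T_b((u',0),(·,w''),·) = u'ᵀB_π(w'',·)`: EVERY oil
direction `u'` lies in the radical of some slice `w'' ≠ 0`, so the slices exhaust the oil space.
[cite: Carlet2020, §5.2] -/
def BalancedQuadraticDegenerate : Prop :=
  ∀ (m : ℕ) (π : (Fin m → Bool) ≃ (Fin m → Bool)), (∀ i, IsDegLeFun 2 fun x => π x i) →
    ∀ c : Fin m → Bool, c ≠ zeroVec →
      ∃ w : Fin m → Bool, w ≠ zeroVec ∧ ∀ v y, deriv2 (fun x => bdot c (π x)) w v y = false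

/-- **OIL RECOVERY ∈ FBPP on the exact MM side** (the line's OPEN stub = Transfer C⁻⁻ of the idea card, stated as
the Las Vegas SPECIFICATION the decider needs). There is a polynomial-time string function `find` and a coin
polynomial `p` such that for every two-circuit instance `I` (`n` even, `B₂`-circuits of 𝔽₂-degree `≤ 3`) which is
EXACT (`Φ = ±1`) and whose second function `g` HAS a half-dimensional M-subspace, at least `2/3` of the coin strings
make `find ⟨code I, y⟩` the register code of a list of rows spanning a CERTIFIED M-subspace of `g`
(`SpansMSubspace`). Only `g`'s circuit is constrained in substance (the first circuit is any cubic `B₂`-circuit; the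
intended witness never reads it): the card's C⁻⁻ solves the SUPERSET problem "any quadratic permutation `π`, any
cubic `h`, any affine disguise" — `Φ = ±1` is kept in the statement only because the composition needs no more and
it hands the prover bentness (`π` a permutation) for the exhaustion step. Implied by the r7 line's
`PolarRadicalSeeds.MSubspaceFinder` (`oilFinder_of_mSubspaceFinder`): ONE finder debt serves both cruxes.
Intended witness (card + triage): `O(n)` random slices `w` → `R_w` by elimination (`F2Elim`) → keep `u ∈ R_w` with
`|R_u| ≤ 2^{n/2}`-type half-rank filter → greedy pairwise-COMPATIBLE extraction (`T_b(u,u',·) = 0` and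
`D_uD_{u'} b(0) = 0`, both linear tests = the E-closure of BIISO.md) → stop at dimension `n/2` and certify; Las
Vegas, so only the RUNNING TIME is open: worst case over all biquadratic `π` (census object of TRIAGE r1-2 §2:
an indecomposable biquadratic `π`, `m ≥ 6`, no affine component either side, all differential kernels `≥ 2`).
[cite: KipnisShamir1998, §4 (oil space of balanced Oil & Vinegar by invariant subspaces)] -/
def OilFinder : Prop :=
  ∃ find ∈ FP, ∃ p : Polynomial ℕ, ∀ (I : KForrelationInstance) (hk : I.k = 2),
    Even I.n → I.IsOverB2 → (∀ i, IsDegLeFun 3 (I.C i).eval) → (I.value = 1 ∨ I.value = -1) →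
    HasMSubspace (I.C (Fin.cast hk.symm 1)).eval →
    (2 / 3 : ℝ) ≤ uniformProb (p.eval I.encode.length)
      {y | ∃ L : List (List Bool), find (boolPair I.encode y) = encList L ∧
        SpansMSubspace I.n (I.C (Fin.cast hk.symm 1)).eval L}

/-- **WINDOW SIGN READOUT** (companion card `window-sign-leak`: `c = a(λ̂) ⊕ b(0)`; corollary of the LANDED sign
transport ★ `DerivativeWalsh.coset_sum_eq_of_forrelation_eq_one / _neg_one`). If `Φ(a,b) = ±1`, `V ∋ 0` is
xor-closed with `|V|² = 2ⁿ`, and `b` is AFFINE ON `V` with slope `s` (`(-1)^{b(v)} = (-1)^{b(0)} (-1)^{s·v}` on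
`V`), then `Φ(a,b) = (-1)^{a(s) + b(0)}`. Proof: the re-twisted pair `(a(· ⊕ s), b ⊕ s·)` has the same `Φ` and its
second function is CONSTANT on `V`; ★ with `U = V^⊥` (`perp_perp_eq_of_sq`), `r = 0`:
`|V^⊥| · |V| · (-1)^{b(0)} = Φ · 2^{n/2} · ∑_{x ∈ V^⊥} (-1)^{a(x ⊕ s)}`, so the right sum is `±|V^⊥|`, all its terms
agree (`all_eq_of_sum_eq_card`), and the term at `x = 0` gives `(-1)^{a(s)} = Φ · (-1)^{b(0)}`. Only ONE flat of
`b` is used (no M-subspace, no duality, no inversion of the hidden permutation).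
[cite: Carlet2020, Thm 14 (§6.1.21, dual of an MM function)] -/
def WindowSignReadout : Prop :=
  ∀ (n : ℕ) (a b : (Fin n → Bool) → Bool) (V : Finset (Fin n → Bool)) (s : Fin n → Bool),
    (forrelation a b = 1 ∨ forrelation a b = -1) → zeroVec ∈ V → (∀ x ∈ V, ∀ y ∈ V, bxor x y ∈ V) →
    (V.card : ℝ) ^ 2 = (2 : ℝ) ^ n → (∀ v ∈ V, signOf (b v) = signOf (b zeroVec) * twist s v) →
    (forrelation a b = 1 ↔ a s = b zeroVec)

/-- Side conditions of the MM SIDE of the signed exact slice with value `s`: `B₂`-circuits, `Φ = s`, two circuits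
the second of which computes a function WITH a half-dimensional M-subspace, `n` even, both of degree `≤ 3`. -/
def MMExactConds (s : ℝ) (I : KForrelationInstance) : Prop :=
  I.IsOverB2 ∧ I.value = s ∧ (∃ hk : I.k = 2, HasMSubspace (I.C (Fin.cast hk.symm 1)).eval) ∧ Even I.n ∧
    ∀ i, IsDegLeFun 3 (I.C i).eval

/-- The MM side of the signed exact slice: YES `Φ = 1` / NO `Φ = -1`, second function with an M-subspace. -/
def mmExactProblem : PromiseProblem :=
  ⟨KForrelationInstance.encode '' {I | MMExactConds 1 I}, KForrelationInstance.encode '' {I | MMExactConds (-1) I}⟩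

/-- **The MM side of the signed exact slice is in `PromiseBPP'`** (conclusion of the decider stub). -/
def MMExactSliceInPrBPP : Prop := mmExactProblem ∈ PromiseBPP'

/-- Crux r5 `ExactPairsMaioranaMcFarland` in DILLON FORM over an even number of bits: the second function of every
exactly forrelated cubic pair has a half-dimensional M-subspace. Verbatim the hypothesis `hDillon` of the r7 line's
bonus theorem `PolarRadicalSeeds.not_signedExactNotPrBPP_of`. [cite: Carlet2020, Prop. 54] -/
def ExactPairsHaveMSubspace : Prop :=
  ∀ (n : ℕ), Even n → ∀ f g : (Fin n → Bool) → Bool, IsDegLeFun 3 f → IsDegLeFun 3 g →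
    forrelation f g = 1 → HasMSubspace g

/-! ## Registered stubs (the only `sorry`s of the file) -/

/-- stub (M in Lean, provable now — THE LEVER): slice heredity, linear algebra over `𝔽₂` behind a Boolean↔`ZMod 2`
bridge for third differences of `IsDegLeFun 3` functions (`deriv3` is constant in `y`, trilinear, symmetric;
`LinearMap.finrank_range_add_finrank_ker`, `Submodule.finrank_sup_add_finrank_inf_eq`,
`Subspace.finrank_dualAnnihilator_eq`; or a direct counting proof on finsets). Same mathematics as the r7 line's
abstract `PolarRadicalSeeds.SeedHeredity` (prove one, port the other). -/
theorem stub_sliceHeredity : SliceHeredity := by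
  sorry

/-- stub (M, provable now): balanced quadratic ⇒ degenerate symplectic form, via the Gauss-sum identity
`(∑_x (-1)^{q x})² = 2^m ∑_{u ∈ rad β_q} (-1)^{q u + q 0}` (reindex `x ↦ x ⊕ u`, `D_u q` affine with linear part
`β_q(u,·)`, character sums `Simon.sum_twist`) and balancedness of a non-zero component of a bijection
(`∑_x (-1)^{c·π x} = ∑_z (-1)^{c·z} = 0`, `Equiv.sum_comp`). Needs the bridge `twist c z = signOf (bdot c z)`. -/
theorem stub_balancedDegenerate : BalancedQuadraticDegenerate := by
  sorry

/-- stub (L–XL, OPEN running time — the line's own crux; Transfer C⁻⁻ of the idea card): the slice-radical oil finder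
meets the specification `OilFinder`. Uses `SliceHeredity` (seeds exist in every slice radical; half-rank filter)
and `BalancedQuadraticDegenerate` (every oil direction is produced; together with heredity the produced directions
cannot hide in a subspace of codimension `d` unless `2^{m-d}` components of `π` have mean radical dimension `≥ d`,
card §Why (2)), the normal form behind an M-subspace of a BENT cubic (`π` a biquadratic permutation: Negative-note
F0), the E-closure / compatible extraction (BIISO.md F2–F3), intrinsic certification; machine side over `CodeFP`
(`ForrCode.evalP_codeFP`, `F2Elim`, the ANF-interpolation bricks of `CubicForrelationEstimatorMachine.lean`).
Cheapest falsifier: ONE biquadratic `π` (indecomposable, no affine component/direction on either side, all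
differential kernels `≥ 2`, `m ∈ [6,12]`) on which `oil_window_pure.py` / biiso v3 need super-polynomially many
slices — none is known (TRIAGE r1-2 census j012921: none at `m ≤ 5`; cube×cube passes every clause but
indecomposability and is solved). Honest seam: differential-degeneracy-rich `π` flood the rank filter (Feistel:
100 % of junk passes, TRIAGE r1-3 §B) — there `Rad T_b ≠ 0` / linear structures take over (algorithm Q), and the
dichotomy between the two regimes is the unproved heart of this stub. -/
theorem stub_oilRecovery : SliceHeredity → BalancedQuadraticDegenerate → OilFinder := by
  sorry

/-- stub (M, provable now from the landed `ForrelationSignTransport.lean` + `ForrelationMSubspaceDuality.lean`: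
`coset_sum_eq_of_forrelation_eq_one/_neg_one`, `bxor_mem_perp`, `perp_perp_eq_of_sq`, `all_eq_of_sum_eq_card`,
and the `Φ`-invariance of the re-twist `(a(· ⊕ s), b ⊕ s·)` — cf. `hfsum` in `dual_affine_on_perp_cosets`). -/
theorem stub_windowSign : WindowSignReadout := by
  sorry

/-- stub (XL formalisation, mathematics closed given its hypotheses): the DECIDER of the MM side of the exact slice.
Machine (`dec ∈ FP`, one bit): parse `⟨code I, y⟩`; run `find` on the coins; decode the rows `L`; CERTIFY
`SpansMSubspace` (rank `n/2` by `F2Elim`; for cubic `g` each `D_uD_v g`, `u v` among the rows, has degree `≤ 1`, so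
it vanishes identically iff it vanishes at `0` and at the `n` unit vectors — `O(n³)` circuit evaluations; pairs of
rows suffice); if not certified output `true`; else read the slope `σ_j = g(v_j) ⊕ g(0)` on the rows, solve the
linear system `s·v_j = σ_j` (consistent by `AffineOnCosets` at `y = 0`), and output `[f(s) = g(0)]`. By
`WindowSignReadout` the output is CORRECT whenever a certificate was found (whatever rows were found), and by
`OilFinder` a certificate is found with probability `≥ 2/3` on every MM-side exact instance; finish with
`PromiseProblem.mem_PromiseBPP'_of_fp_decider` (`PromiseBPPFromFPDecider.lean`). Deterministic given the rows — no
sampling, no Chebyshev (contrast the thresholded r7 decider). -/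
theorem stub_exactDecider : OilFinder → WindowSignReadout → MMExactSliceInPrBPP := by
  sorry

/-- stub (M, provable now — Dillon's criterion, easy direction, at every `m`): the Maiorana–McFarland normal form
`g (e (y', y'')) = y'·perm(y'') + h(y'')` behind an affine bijection `e(y) = My + c` (the verbatim conclusion of
crux r5) yields the M-subspace `V = M({y'' = 0}) = {e(y',0) ⊕ e(0,0)}`: xor-closed, `|V| = 2^m`, and every coset
of `V` is `{e(y', y₀'') : y'}`, on which `g` is affine in `y'`. Template: `Negative.DillonCertificate.mm_family`
(the same computation at `m = 5`: `ind_bx`, `append_bx`, `mm_four_sum`, `xor4_of_ind`), plus `Even n ↔ n = m + m`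
(`obtain ⟨m, rfl⟩`) and the cast `(2^m : ℝ)² = 2^{m+m}`. -/
theorem stub_dillonOfMM : ExactPairsMaioranaMcFarland → ExactPairsHaveMSubspace := by
  sorry

/-! ## Name-keyed aliases of the stub statements

(Each alias is DEFINITIONALLY the statement of the stub of the same name — see the wiring `example` after the
composition; the pattern of the r7 line, kept so a skeleton audit keyed on stub names reads the hypotheses.) -/
namespace Registered

/-- Alias of the statement of `stub_sliceHeredity`. -/
abbrev stub_sliceHeredity : Prop := SliceHeredity
/-- Alias of the statement of `stub_balancedDegenerate`. -/
abbrev stub_balancedDegenerate : Prop := BalancedQuadraticDegenerate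
/-- Alias of the statement of `stub_oilRecovery`. -/
abbrev stub_oilRecovery : Prop := SliceHeredity → BalancedQuadraticDegenerate → OilFinder
/-- Alias of the statement of `stub_windowSign`. -/
abbrev stub_windowSign : Prop := WindowSignReadout
/-- Alias of the statement of `stub_exactDecider`. -/
abbrev stub_exactDecider : Prop := OilFinder → WindowSignReadout → MMExactSliceInPrBPP
/-- Alias of the statement of `stub_dillonOfMM`. -/
abbrev stub_dillonOfMM : Prop := ExactPairsMaioranaMcFarland → ExactPairsHaveMSubspace

end Registered

/-! ## Composition: the stubs and crux r5 refute the crux BY NAME -/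

/-- `Φ(¬f, g) = -Φ(f, g)` (complementing the first function flips the sign). [cite: AaronsonAmbainis2018, §1.1.3] -/
theorem forrelation_not_left (f g : (Fin n → Bool) → Bool) :
    forrelation (fun x => !f x) g = -forrelation f g := by
  unfold forrelation
  rw [← mul_neg, ← Finset.sum_neg_distrib]
  congr 1
  refine Finset.sum_congr rfl fun x _ => ?_
  rw [← Finset.sum_neg_distrib]
  refine Finset.sum_congr rfl fun y _ => ?_
  rw [DerivativeWalsh.signOf_not]
  ring

/-- With r5 in Dillon form, the second function of every EXACT cubic two-circuit instance (`Φ = ±1`; for `Φ = -1`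
apply it to `(¬f, g)`) has a half-dimensional M-subspace: exact instances are MM-side instances. -/
theorem hasMSubspace_of_exact (hDil : ExactPairsHaveMSubspace) :
    ∀ (I : KForrelationInstance) (hk : I.k = 2), (I.value = 1 ∨ I.value = -1) → Even I.n →
      (∀ i, IsDegLeFun 3 (I.C i).eval) → HasMSubspace (I.C (Fin.cast hk.symm 1)).eval := by
  rintro ⟨n, k, C⟩ hk hv hn hdeg
  dsimp only at hk hn hdeg hv ⊢
  subst hk
  rw [KForrelationInstance.value_mk_two] at hv
  show HasMSubspace (C 1).eval
  rcases hv with h | h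
  · exact hDil n hn _ _ (hdeg 0) (hdeg 1) h
  · refine hDil n hn (fun x => !(C 0).eval x) _ (hdeg 0).not (hdeg 1) ?_
    rw [forrelation_not_left, h, neg_neg]

/-- **THE COMPOSITION (negative).** Slice heredity and balanced-degeneracy feed the oil finder; the finder and the
window readout give a `PromiseBPP'` decider of the MM side of the exact slice; crux r5 (BY NAME, via the Dillon-form
stub) makes the MM side the WHOLE exact slice; so the signed exact slice is in `PromiseBPP'`, refuting crux r3.
The only work done here is promise bookkeeping. -/
theorem not_SignedExactCubicForrelationNotPrBPP_of (hH : Registered.stub_sliceHeredity)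
    (hB : Registered.stub_balancedDegenerate) (hF : Registered.stub_oilRecovery)
    (hW : Registered.stub_windowSign) (hD : Registered.stub_exactDecider)
    (hDil : Registered.stub_dillonOfMM) (r5 : ExactPairsMaioranaMcFarland) :
    ¬ SignedExactCubicForrelationNotPrBPP := by
  intro hcrux
  apply hcrux
  show signedExactCubicForrelationProblem 2 ∈ PromiseBPP'
  obtain ⟨L', hL', p, hyes, hno⟩ := hD (hF hH hB) hW
  have key := hasMSubspace_of_exact (hDil r5)
  refine ⟨L', hL', p, fun x hx => hyes x ?_, fun x hx => hno x ?_⟩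
  · obtain ⟨I, hI, rfl⟩ := hx
    exact ⟨I, ⟨hI.1, hI.2.1, ⟨hI.2.2.1, key I hI.2.2.1 (Or.inl hI.2.1) hI.2.2.2.1 hI.2.2.2.2⟩,
      hI.2.2.2.1, hI.2.2.2.2⟩, rfl⟩
  · obtain ⟨I, hI, rfl⟩ := hx
    exact ⟨I, ⟨hI.1, hI.2.1, ⟨hI.2.2.1, key I hI.2.2.1 (Or.inr hI.2.1) hI.2.2.2.1 hI.2.2.2.2⟩,
      hI.2.2.2.1, hI.2.2.2.2⟩, rfl⟩

/-- Wiring check: the declared stubs feed the composition exactly as stated (each alias is the stub's type); crux r5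
`ExactPairsMaioranaMcFarland` (stmt-QuantumAdvantage-2205, open route item) is the only external hypothesis. -/
example (r5 : ExactPairsMaioranaMcFarland) : ¬ SignedExactCubicForrelationNotPrBPP :=
  not_SignedExactCubicForrelationNotPrBPP_of stub_sliceHeredity stub_balancedDegenerate stub_oilRecovery
    stub_windowSign stub_exactDecider stub_dillonOfMM r5

/-! ## Sanity checks against the crux and its negative knowledge (sorry-free) -/

/-- The crux, by name, is non-membership of the tree's `signedExactCubicForrelationProblem 2`
(`signedExactCubicForrelationProblem_two_eq` is `rfl`). -/
example : SignedExactCubicForrelationNotPrBPP = (signedExactCubicForrelationProblem 2 ∉ PromiseBPP') := rfl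

/-- `MMExactSliceInPrBPP` is a SUB-promise statement of `¬ crux` (so `stub_exactDecider`'s conclusion is never
falser than the refutation it serves): if the signed exact slice is in `PromiseBPP'` then so is its MM side. -/
example (h : ¬ SignedExactCubicForrelationNotPrBPP) : MMExactSliceInPrBPP := by
  have hmem : signedExactCubicForrelationProblem 2 ∈ PromiseBPP' := by
    by_contra habs
    exact h habs
  obtain ⟨L', hL', p, hyes, hno⟩ := hmem
  refine ⟨L', hL', p, fun x hx => hyes x ?_, fun x hx => hno x ?_⟩
  · obtain ⟨I, hI, rfl⟩ := hx
    obtain ⟨hk, -⟩ := hI.2.2.1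
    exact ⟨I, ⟨hI.1, hI.2.1, hk, hI.2.2.2⟩, rfl⟩
  · obtain ⟨I, hI, rfl⟩ := hx
    obtain ⟨hk, -⟩ := hI.2.2.1
    exact ⟨I, ⟨hI.1, hI.2.1, hk, hI.2.2.2⟩, rfl⟩

/-- The r7 line's finder specification (`PolarRadicalSeeds.MSubspaceFinder`, restated verbatim — Cruxes files are not
importable): M-subspace recovery on the whole THRESHOLDED promise `|Φ| ≥ 3/5`. -/
def MSubspaceFinder : Prop :=
  ∃ find ∈ FP, ∃ p : Polynomial ℕ, ∀ (I : KForrelationInstance) (hk : I.k = 2),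
    Even I.n → I.IsOverB2 → (∀ i, IsDegLeFun 3 (I.C i).eval) → (3 / 5 : ℝ) ≤ |I.value| →
    HasMSubspace (I.C (Fin.cast hk.symm 1)).eval →
    (2 / 3 : ℝ) ≤ uniformProb (p.eval I.encode.length)
      {y | ∃ L : List (List Bool), find (boolPair I.encode y) = encList L ∧
        SpansMSubspace I.n (I.C (Fin.cast hk.symm 1)).eval L}

/-- ONE finder debt for two cruxes: the r7 line's `MSubspaceFinder` implies this line's `OilFinder`
(`|±1| = 1 ≥ 3/5`). -/
theorem oilFinder_of_mSubspaceFinder (h : MSubspaceFinder) : OilFinder := by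
  obtain ⟨find, hfind, p, hp⟩ := h
  refine ⟨find, hfind, p, fun I hk hn hB hdeg hv hM => hp I hk hn hB hdeg ?_ hM⟩
  rcases hv with h | h <;> rw [h] <;> norm_num

/-! ### The namesake corollary: every slice radical contains a non-zero oil vector (F1), from heredity -/

theorem deriv_zeroVec (f : (Fin n → Bool) → Bool) (y : Fin n → Bool) : deriv f zeroVec y = false := by
  simp [deriv]

theorem bxor_bxor_cancel_right (y w : Fin n → Bool) : bxor (bxor y w) w = y := by
  funext i
  simp

/-- `0 ∈ R_w`. -/
theorem zeroVec_mem_sliceRad (b : (Fin n → Bool) → Bool) (w : Fin n → Bool) : zeroVec ∈ sliceRad b w := by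
  rw [mem_sliceRad]
  intro v y
  exact deriv_zeroVec _ _

/-- `w ∈ R_w` (`D_w D_w = 0`: the slices are alternating). -/
theorem self_mem_sliceRad (b : (Fin n → Bool) → Bool) (w : Fin n → Bool) : w ∈ sliceRad b w := by
  rw [mem_sliceRad]
  intro v y
  simp only [deriv3, deriv2, deriv, bxor_bxor_cancel_right]
  generalize b y = p
  generalize b (bxor y v) = q
  generalize b (bxor y w) = r
  generalize b (bxor (bxor y w) v) = t
  revert p q r t
  decide

/-- **SliceRadicalOil (the idea card's first lemma = PolarLeak = Negative-note F1), from heredity.** For a cubic `b`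
with a half-dimensional M-subspace `V` (`|V|² = 2ⁿ`, `|V| ≥ 2`) and any direction `w ≠ 0`, the slice radical `R_w`
contains a NON-ZERO vector of `V`. -/
theorem sliceRadicalOil_of_heredity (hH : SliceHeredity) (b : (Fin n → Bool) → Bool)
    (V : Finset (Fin n → Bool)) (hb : IsDegLeFun 3 b) (h0 : zeroVec ∈ V)
    (hadd : ∀ x ∈ V, ∀ y ∈ V, bxor x y ∈ V) (hM : AffineOnCosets b V) (hcard : V.card ^ 2 = 2 ^ n)
    {w : Fin n → Bool} (hw : w ≠ zeroVec) :
    ∃ u ∈ V, u ≠ zeroVec ∧ u ∈ sliceRad b w := by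
  have hle := hH n b V hb h0 hadd hM w
  rw [hcard] at hle
  have hpos : 0 < 2 ^ n := pow_pos (by norm_num) n
  have hle' : (sliceRad b w).card ≤ (sliceRad b w ∩ V).card ^ 2 := Nat.le_of_mul_le_mul_right hle hpos
  -- `{0, w} ⊆ R_w`, so `|R_w| ≥ 2`
  have htwo : 2 ≤ (sliceRad b w).card := by
    have hsub : ({zeroVec, w} : Finset (Fin n → Bool)) ⊆ sliceRad b w := by
      intro u hu
      rcases Finset.mem_insert.1 hu with rfl | hu
      · exact zeroVec_mem_sliceRad b w
      · rw [Finset.mem_singleton.1 hu]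
        exact self_mem_sliceRad b w
    have hc : ({zeroVec, w} : Finset (Fin n → Bool)).card = 2 := Finset.card_pair (Ne.symm hw)
    calc 2 = ({zeroVec, w} : Finset (Fin n → Bool)).card := hc.symm
      _ ≤ (sliceRad b w).card := Finset.card_le_card hsub
  -- hence `|R_w ∩ V| ≥ 2`, and a two-element finset has an element other than `0`
  have hone : 1 < (sliceRad b w ∩ V).card := by
    by_contra hle1
    push Not at hle1
    have : (sliceRad b w ∩ V).card ^ 2 ≤ 1 := by
      calc (sliceRad b w ∩ V).card ^ 2 ≤ 1 ^ 2 := Nat.pow_le_pow_left hle1 2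
        _ = 1 := by norm_num
    omega
  obtain ⟨u, hu, hne⟩ := Finset.exists_mem_ne hone zeroVec
  exact ⟨u, (Finset.mem_inter.1 hu).2, hne, (Finset.mem_inter.1 hu).1⟩

/-! ### `Negative.GoldCube`: the `Rad T = 0` family is inside the lever's reach -/

open Summit.QuantumAdvantage.QuantumAdvantage.Theorems.SignedCubicForrelationInPrBPP.Negative (goldCubePerm
  exists_biquadratic_perm_without_affine_component)

/-- Biquadratic permutations WITHOUT affine component exist (`x³` on `𝔽₈`, Disproof-side negative knowledge of the
sibling crux): this line's finder never starts from an affine component, a linear structure or `Rad T_b`. -/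
example : ∃ π : Equiv.Perm (Fin 3 → Bool), (∀ i, IsDegLeFun 2 fun x => π x i) ∧
    (∀ i, IsDegLeFun 2 fun x => π.symm x i) ∧
    ∀ ℓ : Fin 3 → Bool, ℓ ≠ (fun _ => false) →
      ¬ IsDegLeFun 1 fun x =>
        Summit.QuantumAdvantage.QuantumAdvantage.Theorems.SignedCubicForrelationInPrBPP.Negative.dotB ℓ (π x) :=
  exists_biquadratic_perm_without_affine_component

/-- … and `BalancedQuadraticDegenerate` holds on it (all seven non-zero components of `x³` have a non-zero radical
vector; `m = 3` odd, so every alternating form is degenerate — checked by `decide`). -/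
example : ∀ c : Fin 3 → Bool, c ≠ zeroVec →
    ∃ w : Fin 3 → Bool, w ≠ zeroVec ∧ ∀ v y, deriv2 (fun x => bdot c (goldCubePerm x)) w v y = false := by
  decide

end Summit.QuantumAdvantage.QuantumAdvantage.Cruxes.SignedExactCubicForrelationNotPrBPP.OilSliceRadicals

end
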